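import Literature.Geometry.Lorentzian.Basic
import Literature.Geometry.Lorentzian.ConnectionNaturality
import Literature.Geometry.Lorentzian.ChartConnection
import Literature.Geometry.Lorentzian.HypersurfaceRestriction
import HarnessLib

/-!
# A chart of the maximal atlas as a local isometry: the transported metric on the chart target
# and the Levi-Civita connection of fields pushed forward from the chart
(family `gr`, in support of **gr.S09**; namespace `Literature.Geometry.Lorentzian.AtlasChart`)

Support file (everything proved; no named facts) for the discharge of
`Literature.Geometry.Lorentzian.minimalGraph_strongMaximumPrinciple` (Andersson–Galloway–Howard
1998, Thm. 3.10 for minimal graphs), which `TangencyMaximumPrinciple.lean` has reduced to the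
construction of a minimal-graph operator `MinimalGraphOperator h ψ T` for every chart `ψ` of the
**maximal** `C^∞` atlas of a Riemannian `3`-manifold `(X, h)` (Fontenele–Silva, Illinois J. Math.
45 (2001), Lemma 3.1, Props. 3.2, 3.4, with the chart inverse in place of `exp_p`). That
construction computes the mean curvature of a piece of surface inside `ψ.source` in the
coordinates of `ψ`; the present file provides the transport of the metric and of the connection
to the chart target, for an arbitrary `ψ ∈ IsManifold.maximalAtlas (𝓡 3) ∞ X` (the trivialisations
of `TX`, hence the frame formulas of the tree, are indexed by the charts of the atlas of `X` only):

* `AtlasChart.target ψ` — the chart target as an open submanifold of `E3`; `AtlasChart.inv ψ` —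
  the inverse chart `Ψ : ψ.target → X`, smooth with invertible differential
  (`contMDiff_inv`, `isInvertible_mfderiv_inv`);
* `AtlasChart.metric g hψ = Ψ^* g` — the transported metric on the target
  (`PseudoRiemannianMetric.comap`), Riemannian when `g` is (`isRiemannian_metric`), with a
  representative `AtlasChart.metricRepr` on `E3` (`metric_val_eq_repr`), so that the coordinate
  calculus of `ChartCalculus.lean`/`ChartConnection.lean` (`OpensChart.christoffel`,
  `OpensChart.leviCivita_apply_eq`) applies on the target;
* `AtlasChart.mpullback_chart_apply`, `mdifferentiableAt_mpullback_chart`,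
  `mpullback_inv_mpullback_chart` — the field `ψ^* Y` on `X` obtained from a field `Y` on `E3`
  (`VectorField.mpullback` along `ψ`): its values `dΨ (Y ∘ ψ)` on `ψ.source`, its
  differentiability, and `Ψ^* (ψ^* Y) = Y` on the target;
* `AtlasChart.leviCivita_mpullback_chart` — **the connection of a pushed-forward field in the
  chart**: `∇^g_{dΨ_p w} (ψ^* Y) = dΨ_p (DY(p) w + Γ'_p(Y p)(w))`, `Γ'` the Christoffel map of
  `Ψ^* g` (naturality of the Levi-Civita connection under the local isometry `Ψ`,
  `leviCivita_comap_mpullback_apply` of `ConnectionNaturality.lean`, O'Neill 1983, Ch. 3,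
  Prop. 3.59, followed by the coordinate formula `OpensChart.leviCivita_apply_eq`, O'Neill 1983,
  Ch. 3, Prop. 3.13).

With the last formula, the covariant derivative `D_v ν` of the unit normal of a surface piece
inside `ψ.source` is computed from any extension `Y` of `dψ ∘ ν` to the chart target
(`covariantDerivAlong_comp_holds`), which is how the minimal-graph operator is obtained.

## References

* B. O'Neill, *Semi-Riemannian geometry with applications to relativity*, Academic Press 1983,
  Ch. 3, Prop. 3.13 (Christoffel symbols), Prop. 3.59 and pp. 90–91 (local isometries preserve
  the Levi-Civita connection).
* F. Fontenele, S. L. Silva, *A tangency principle and applications*, Illinois J. Math. 45 (2001)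
  213–228, §3.
-/

noncomputable section

open Bundle Set Function Filter VectorField TopologicalSpace Manifold
open scoped Manifold ContDiff Topology

namespace Literature.Geometry.Lorentzian

namespace AtlasChart

variable {X : Type*} [TopologicalSpace X] {ψ : OpenPartialHomeomorph X E3}

/-! ### The chart target and the inverse chart -/

variable (ψ) in
/-- The target of the chart `ψ` as an open submanifold of `E3`. [folklore] -/
abbrev target : Opens E3 :=
  ⟨ψ.target, ψ.open_target⟩

variable (ψ) in
/-- The inverse chart `Ψ : ψ.target → X`, `Ψ p = ψ⁻¹ p`, as a map from the open submanifold
`ψ.target` of `E3`. [folklore] -/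
def inv : target ψ → X :=
  fun p ↦ ψ.symm p

/-- Unfolding lemma: `inv ψ p = ψ⁻¹ p`. [folklore] -/
@[simp]
lemma inv_apply (p : target ψ) : inv ψ p = ψ.symm p := rfl

/-- The inverse chart lands in the chart source. [folklore] -/
lemma inv_mem_source (p : target ψ) : inv ψ p ∈ ψ.source :=
  ψ.map_target p.2

/-- `ψ (ψ⁻¹ p) = p` on the target. [folklore] -/
@[simp]
lemma apply_inv (p : target ψ) : ψ (inv ψ p) = p :=
  ψ.right_inv p.2

variable [ChartedSpace E3 X]

/-- A chart of the maximal `C^∞` atlas is differentiable with differentiable inverse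
(`contMDiffOn_of_mem_maximalAtlas`, `contMDiffOn_symm_of_mem_maximalAtlas`). [folklore] -/
theorem mdifferentiable_chart (hψ : ψ ∈ IsManifold.maximalAtlas (𝓡 3) ∞ X) :
    ψ.MDifferentiable (𝓡 3) (𝓡 3) :=
  ⟨(contMDiffOn_of_mem_maximalAtlas hψ).mdifferentiableOn (by simp),
    (contMDiffOn_symm_of_mem_maximalAtlas hψ).mdifferentiableOn (by simp)⟩

/-- The inverse chart is smooth (`C^{∞ + 1} = C^∞`, the regularity asked by
`PseudoRiemannianMetric.comap`). [folklore] -/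
theorem contMDiff_inv (hψ : ψ ∈ IsManifold.maximalAtlas (𝓡 3) ∞ X) :
    ContMDiff 𝓘(ℝ, E3) (𝓡 3) (∞ + 1) (inv ψ) := by
  have h : ((∞ : ℕ∞ω) + 1) = ∞ := rfl
  rw [h]
  exact (contMDiffOn_symm_of_mem_maximalAtlas hψ).comp_contMDiff contMDiff_subtype_val
    fun p ↦ p.2

/-- The inverse chart is smooth of class `C^∞`. [folklore] -/
theorem contMDiff_inv' (hψ : ψ ∈ IsManifold.maximalAtlas (𝓡 3) ∞ X) :
    ContMDiff 𝓘(ℝ, E3) (𝓡 3) ∞ (inv ψ) :=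
  (contMDiff_inv hψ).of_le le_self_add

/-- The differential of the inverse chart from the open submanifold is the differential of
`ψ.symm` (the inclusion of the open submanifold has the identity as differential). [folklore] -/
theorem mfderiv_inv (hψ : ψ ∈ IsManifold.maximalAtlas (𝓡 3) ∞ X) (p : target ψ) :
    mfderiv 𝓘(ℝ, E3) (𝓡 3) (inv ψ) p = mfderiv 𝓘(ℝ, E3) (𝓡 3) ψ.symm (p : E3) :=
  mfderiv_comp_subtypeVal (f := ψ.symm) ((mdifferentiable_chart hψ).symm.mdifferentiableAt p.2)

/-- The differential of the inverse chart is invertible. [folklore] -/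
theorem isInvertible_mfderiv_inv (hψ : ψ ∈ IsManifold.maximalAtlas (𝓡 3) ∞ X) (p : target ψ) :
    (mfderiv 𝓘(ℝ, E3) (𝓡 3) (inv ψ) p).IsInvertible := by
  rw [mfderiv_inv hψ]
  exact ⟨(mdifferentiable_chart hψ).symm.mfderiv p.2, rfl⟩

/-- The differential of the inverse chart is injective. [folklore] -/
theorem injective_mfderiv_inv (hψ : ψ ∈ IsManifold.maximalAtlas (𝓡 3) ∞ X) :
    ∀ p : target ψ, Function.Injective (mfderiv 𝓘(ℝ, E3) (𝓡 3) (inv ψ) p) := fun p ↦ by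
  rw [mfderiv_inv hψ]
  exact (mdifferentiable_chart hψ).symm.mfderiv_injective p.2

/-- The inverse of the differential of the chart at a point of its source is the differential of
the inverse chart. [folklore] -/
theorem inverse_mfderiv_chart (hψ : ψ ∈ IsManifold.maximalAtlas (𝓡 3) ∞ X) {x : X}
    (hx : x ∈ ψ.source) :
    (mfderiv (𝓡 3) 𝓘(ℝ, E3) ψ x).inverse = mfderiv 𝓘(ℝ, E3) (𝓡 3) ψ.symm (ψ x) := by
  have h : mfderiv (𝓡 3) 𝓘(ℝ, E3) ψ x =
      ((mdifferentiable_chart hψ).mfderiv hx).toContinuousLinearMap := by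
    ext v
    rfl
  rw [h, ContinuousLinearMap.inverse_equiv]
  ext v
  rfl

/-! ### Fields pushed forward from the chart target -/

/-- A vector field on the normed space `E3` is differentiable at `q` as a section of `TE3` iff it
is Fréchet differentiable at `q` (the preferred trivialisation of `TE3` is the identity).
[folklore] -/
theorem mdifferentiableAt_section_modelSpace_iff {Y : Π q : E3, TangentSpace 𝓘(ℝ, E3) q}
    {q : E3} :
    MDifferentiableAt 𝓘(ℝ, E3) (𝓘(ℝ, E3).prod 𝓘(ℝ, E3))
        (fun z : E3 ↦ (TotalSpace.mk' E3 z (Y z) : TangentBundle 𝓘(ℝ, E3) E3)) q ↔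
      DifferentiableAt ℝ (fun z : E3 ↦ (Y z : E3)) q := by
  rw [mdifferentiableAt_section]
  simp only [trivializationAt_model_space_apply]
  exact mdifferentiableAt_iff_differentiableAt

/-- **The pushed-forward field in the chart source.** For a field `Y : E3 → E3` on the chart
target, the field `ψ^* Y` on `X` (`VectorField.mpullback` along `ψ`) takes at `x ∈ ψ.source` the
value `dΨ_{ψ x} (Y (ψ x))` (stated at `x = Ψ p`). [folklore] -/
theorem mpullback_chart_apply (hψ : ψ ∈ IsManifold.maximalAtlas (𝓡 3) ∞ X) (p : target ψ)
    (Y : E3 → E3) :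
    mpullback (𝓡 3) 𝓘(ℝ, E3) ψ (fun q ↦ Y q) (inv ψ p) =
      mfderiv 𝓘(ℝ, E3) (𝓡 3) (inv ψ) p (Y p) := by
  rw [mpullback_apply, inverse_mfderiv_chart hψ (inv_mem_source p), mfderiv_inv hψ]
  have key : ∀ z z' : E3, z = z' →
      (mfderiv 𝓘(ℝ, E3) (𝓡 3) ψ.symm z (Y z) : E3) = mfderiv 𝓘(ℝ, E3) (𝓡 3) ψ.symm z' (Y z') := by
    rintro z _ rfl
    rfl
  exact key _ _ (apply_inv p)

/-- `Ψ^* (ψ^* Y) = Y` on the chart target: pulling the pushed-forward field back along the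
inverse chart returns the original field. [folklore] -/
theorem mpullback_inv_mpullback_chart (hψ : ψ ∈ IsManifold.maximalAtlas (𝓡 3) ∞ X) (Y : E3 → E3)
    (p : target ψ) :
    mpullback 𝓘(ℝ, E3) (𝓡 3) (inv ψ) (mpullback (𝓡 3) 𝓘(ℝ, E3) ψ (fun q ↦ Y q)) p = Y p := by
  rw [mpullback_apply, mpullback_chart_apply hψ p Y]
  exact (isInvertible_mfderiv_inv hψ p).inverse_apply_self _

variable [IsManifold (𝓡 3) ∞ X]

/-! ### The transported metric on the chart target -/

variable (g : PseudoRiemannianMetric (𝓡 3) ∞ E3 (TangentSpace (𝓡 3) : X → Type _))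

/-- **The metric transported to the chart target**: `Ψ^* g` on the open submanifold `ψ.target`
of `E3`, `(Ψ^* g)_p(a, b) = g_{Ψ p}(dΨ a, dΨ b)` (`PseudoRiemannianMetric.comap` along the local
diffeomorphism `Ψ = inv ψ`; smoothness by `contMDiff_pullbackBilin_holds`). By construction `Ψ`
is a local isometry `(ψ.target, Ψ^* g) → (X, g)`. O'Neill 1983, Ch. 3, pp. 90–91.
[cite: ONeill1983, Ch. 3, pp. 90–91] -/
def metric (hψ : ψ ∈ IsManifold.maximalAtlas (𝓡 3) ∞ X) :
    PseudoRiemannianMetric 𝓘(ℝ, E3) ∞ E3 (TangentSpace 𝓘(ℝ, E3) : target ψ → Type _) :=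
  g.comap PseudoRiemannianMetric.contMDiff_pullbackBilin_holds (inv ψ) (contMDiff_inv hψ)
    (injective_mfderiv_inv hψ) rfl

/-- `(Ψ^* g)_p(a, b) = g_{Ψ p}(dΨ_p a, dΨ_p b)`. [cite: ONeill1983, Ch. 3, pp. 90–91] -/
@[simp]
theorem metric_val (hψ : ψ ∈ IsManifold.maximalAtlas (𝓡 3) ∞ X) (p : target ψ) (a b : E3) :
    (metric g hψ).val p a b =
      g.val (ψ.symm p) (mfderiv 𝓘(ℝ, E3) (𝓡 3) (inv ψ) p a)
        (mfderiv 𝓘(ℝ, E3) (𝓡 3) (inv ψ) p b) :=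
  rfl

/-- The transported metric of a Riemannian metric is Riemannian. [folklore] -/
theorem isRiemannian_metric (hψ : ψ ∈ IsManifold.maximalAtlas (𝓡 3) ∞ X) (hg : g.IsRiemannian) :
    (metric g hψ).IsRiemannian := fun p a ha ↦ by
  rw [metric_val]
  exact hg _ _ fun h0 ↦ ha (injective_mfderiv_inv hψ p (h0.trans (map_zero _).symm))

/-- The representative of the transported metric: its components as a function on all of `E3`
(junk value `0` off the target). [folklore] -/
def metricRepr (hψ : ψ ∈ IsManifold.maximalAtlas (𝓡 3) ∞ X) : E3 → E3 →L[ℝ] E3 →L[ℝ] ℝ :=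
  fun p ↦ by
    classical
    exact if hp : p ∈ ψ.target then (metric g hψ).val ⟨p, hp⟩ else 0

/-- The representative represents: `(Ψ^* g).val p = metricRepr p` on the target. [folklore] -/
theorem metric_val_eq_repr (hψ : ψ ∈ IsManifold.maximalAtlas (𝓡 3) ∞ X) :
    ∀ p : target ψ, (metric g hψ).val p = metricRepr g hψ p := fun p ↦ by
  have hp : (p : E3) ∈ ψ.target := p.2
  simp only [metricRepr, dif_pos hp]

/-- The representative is smooth at the points of the target (`OpensChart.contDiffAt_repr`).
[folklore] -/
theorem contDiffAt_metricRepr (hψ : ψ ∈ IsManifold.maximalAtlas (𝓡 3) ∞ X) (p : target ψ) :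
    ContDiffAt ℝ ∞ (metricRepr g hψ) p :=
  OpensChart.contDiffAt_repr (metric_val_eq_repr g hψ) p

/-! ### Differentiability of pushed-forward fields -/

/-- The pushed-forward field of a field differentiable at `ψ x` is differentiable at
`x ∈ ψ.source` as a section of `TX` (Mathlib's `MDifferentiableAt.mpullback_vectorField`: `ψ` is
`C^∞` at `x` with invertible differential). [folklore] -/
theorem mdifferentiableAt_mpullback_chart (hψ : ψ ∈ IsManifold.maximalAtlas (𝓡 3) ∞ X) {x : X}
    (hx : x ∈ ψ.source) {Y : E3 → E3} (hY : DifferentiableAt ℝ Y (ψ x)) :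
    MDifferentiableAt (𝓡 3) ((𝓡 3).prod 𝓘(ℝ, E3))
      (fun x' : X ↦ (TotalSpace.mk' E3 x' (mpullback (𝓡 3) 𝓘(ℝ, E3) ψ (fun q ↦ Y q) x') :
        TangentBundle (𝓡 3) X)) x := by
  have hY' : MDifferentiableAt 𝓘(ℝ, E3) (𝓘(ℝ, E3).prod 𝓘(ℝ, E3))
      (fun z : E3 ↦ (TotalSpace.mk' E3 z (show TangentSpace 𝓘(ℝ, E3) z from Y z) :
        TangentBundle 𝓘(ℝ, E3) E3)) (ψ x) :=
    mdifferentiableAt_section_modelSpace_iff.2 hY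
  have hψx : ContMDiffAt (𝓡 3) 𝓘(ℝ, E3) ∞ ψ x :=
    (contMDiffOn_of_mem_maximalAtlas hψ).contMDiffAt (ψ.open_source.mem_nhds hx)
  have hinv : (mfderiv (𝓡 3) 𝓘(ℝ, E3) ψ x).IsInvertible := by
    refine ⟨(mdifferentiable_chart hψ).mfderiv hx, ?_⟩
    ext v
    rfl
  exact hY'.mpullback_vectorField hψx hinv (WithTop.coe_le_coe.mpr le_top)

/-! ### The connection of a pushed-forward field, in the chart -/

/-- **The Levi-Civita connection of a pushed-forward field, computed in the chart.** Let `g` be a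
smooth metric on `X` (with its Levi-Civita connection), `ψ` a chart of the maximal atlas,
`Ψ = inv ψ` its inverse, `Y : E3 → E3` differentiable at a point `p` of the target and `ψ^* Y`
the pushed-forward field on `X`. Then for every `w ∈ E3`
`∇^g_{dΨ_p w} (ψ^* Y) (Ψ p) = dΨ_p (DY(p) w + Γ'_p(Y p)(w))`,
where `Γ'_p(Z)(w) = OpensChart.christoffel (Ψ^* g) G' p Z w` is the Christoffel map of the
transported metric with components `G' = metricRepr`. Proof: `Ψ : (ψ.target, Ψ^* g) → (X, g)` is
a local isometry, so `∇^{Ψ^*g}_w (Ψ^*(ψ^* Y)) = (dΨ)⁻¹ ∇^g_{dΨ w} (ψ^* Y)`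
(`leviCivita_comap_mpullback_apply`, O'Neill 1983, Ch. 3, Prop. 3.59); `Ψ^*(ψ^* Y) = Y`; and on the
open subset `ψ.target` of `E3` the connection of `Ψ^* g` is `DY + Γ'(Y)`
(`OpensChart.leviCivita_apply_eq`, O'Neill 1983, Ch. 3, Prop. 3.13).
[cite: ONeill1983, Ch. 3, Prop. 3.59 and Prop. 3.13] -/
theorem leviCivita_mpullback_chart [g.HasLeviCivita] (hψ : ψ ∈ IsManifold.maximalAtlas (𝓡 3) ∞ X)
    {Y : E3 → E3} (p : target ψ) (hY : DifferentiableAt ℝ Y p) (w : E3) :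
    g.leviCivita (mpullback (𝓡 3) 𝓘(ℝ, E3) ψ (fun q ↦ Y q)) (ψ.symm p)
        (mfderiv 𝓘(ℝ, E3) (𝓡 3) (inv ψ) p w) =
      mfderiv 𝓘(ℝ, E3) (𝓡 3) (inv ψ) p
        (fderiv ℝ Y p w +
          OpensChart.christoffel (metric g hψ) (metricRepr g hψ) p (Y p) w) := by
  haveI hLC : (metric g hψ).HasLeviCivita := (metric g hψ).hasLeviCivita
  haveI : (g.comap PseudoRiemannianMetric.contMDiff_pullbackBilin_holds (inv ψ) (contMDiff_inv hψ)
      (injective_mfderiv_inv hψ) rfl).HasLeviCivita := hLC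
  -- the pushed-forward field is differentiable at `Ψ p`
  have hYd : MDifferentiableAt (𝓡 3) ((𝓡 3).prod 𝓘(ℝ, E3))
      (fun x' : X ↦ (TotalSpace.mk' E3 x' (mpullback (𝓡 3) 𝓘(ℝ, E3) ψ (fun q ↦ Y q) x') :
        TangentBundle (𝓡 3) X)) (inv ψ p) := by
    refine mdifferentiableAt_mpullback_chart hψ (inv_mem_source p) ?_
    rw [apply_inv]
    exact hY
  -- naturality of the Levi-Civita connection under the local isometry `Ψ`
  have key := g.leviCivita_comap_mpullback_apply PseudoRiemannianMetric.contMDiff_pullbackBilin_holds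
    (contMDiff_inv hψ) (injective_mfderiv_inv hψ) rfl (u := p) hYd w
  -- `Ψ^*(ψ^* Y) = Y` as sections over the target
  have hsec : mpullback 𝓘(ℝ, E3) (𝓡 3) (inv ψ) (mpullback (𝓡 3) 𝓘(ℝ, E3) ψ (fun q ↦ Y q)) =
      fun q : target ψ ↦ (Y q : E3) :=
    funext fun q ↦ mpullback_inv_mpullback_chart hψ Y q
  -- the connection of the transported metric in coordinates
  have hcoord := OpensChart.leviCivita_apply_eq (metric_val_eq_repr g hψ) p
    (W := fun q : target ψ ↦ (Y q : E3)) (Wf := Y) (fun _ ↦ rfl) hY w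
  change (metric g hψ).leviCivita _ p w = _ at key
  rw [hsec, hcoord] at key
  -- apply `dΨ_p` to both sides
  have h := congrArg (mfderiv 𝓘(ℝ, E3) (𝓡 3) (inv ψ) p) key
  rw [(isInvertible_mfderiv_inv hψ p).self_apply_inverse] at h
  exact h.symm

end AtlasChart

end Literature.Geometry.Lorentzian

end
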